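import Summits.QuantumFields.YangMills.Theorems.ConvexGribovBodyCovarianceBoundDefsC
import Summits.QuantumFields.YangMills.Theorems.ConvexGribovBodyCovarianceBoundStubSupMeasurable
import Literature.MathematicalPhysics.QuantumFieldTheory.TiltedExponentMorseBounds
import Literature.MathematicalPhysics.QuantumFieldTheory.CoulombGaugeFPPositivity
import HarnessLib

/-!
# Stub `stub_twistGapMeasurable` for the crux `CovarianceBound` (stmt-QuantumFields-8780), line `Sketch`

Route `QuantumFields/YangMills/ConvexGribovBody`, crux
`Summit.QuantumFields.YangMills.Theses.ConvexGribovBody.CovarianceBound`, skeleton line `Sketch`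
(ideator 4, `twist-stiffness-envelope`). This file proves the registered classical stub
`stub_twistGapMeasurable` over the line's vocabulary
(`Theorems/ConvexGribovBodyCovarianceBoundDefsC.lean`): for a compact group `G` with a faithful
continuous unitary matrix representation `r`, on the torus `(2S+1)⁴`, the TWIST GAP
`twistGap r S j U = perMin r S U - twistMin r S j U` of the Coulomb gauge glass is

1. a Borel measurable function of the configuration `U` — indeed continuous: `perMin` and
   `twistMin` are infima over the COMPACT index spaces `Site → G`, `G × (Site → G)` of jointly
   continuous functions (`IsCompact.continuous_sInf`), and the product σ-algebra of the
   second-countable `G` (closed embedding `ρ`) on `G^{edges}` is Borel;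
2. pinched `0 ≤ twistGap ≤ 6 N (2S+1)³`: the trivial twist `t = 1` is allowed
   (`twistedCoulombF_one`), so `twistMin ≤ perMin`; unitarity `|Re tr ρ(g)| ≤ N` over the
   `3 (2S+1)³` time-zero spatial links gives `|coulombF|, |twistedCoulombF| ≤ 3 N (2S+1)³`.

Helper lemmas live in the sub-namespace `TwistGapMeasurable`. No named facts are used.
-/

set_option autoImplicit false

noncomputable section

namespace Summit.QuantumFields.YangMills.Cruxes.CovarianceBound.TwistStiffness

open scoped BigOperators Matrix ComplexConjugate
open MeasureTheory Literature.MathematicalPhysics.QuantumFieldTheory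
open Summit.QuantumFields.YangMills.Cruxes.CovarianceBound.SupportWindow

variable {G : Type} [Group G] [TopologicalSpace G]

/-! ### Helper lemmas

They live in the sub-namespace `TwistGapMeasurable` (no clash with the other stubs of the line). -/

namespace TwistGapMeasurable

/-! #### A-priori bounds (unitarity of `ρ`) -/

/-- `|Re tr ρ(g)| ≤ N` for the unitary representation `ρ` (`‖ρ(g)‖_F = √N`, Cauchy–Schwarz).
[folklore] -/
theorem abs_re_trace_rho_le (r : LatticeRep G) (g : G) : |(r.ρ g).trace.re| ≤ r.N := by
  have h := OneLinkLaplace.abs_re_trace_le (r.ρ g)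
  rw [OneLinkLaplace.frobNorm_of_mem_unitaryGroup (r.mem_unitary g),
    Real.mul_self_sqrt (Nat.cast_nonneg _)] at h
  exact h

/-- A sum over the `3 (2S+1)³` time-zero spatial links of terms of modulus `≤ N` has modulus
`≤ 3 N (2S+1)³`. [folklore] -/
theorem abs_sum_slice_le (r : LatticeRep G) (S : ℕ) (f : Edge 4 (2 * S + 1) → ℝ)
    (hf : ∀ e, |f e| ≤ r.N) :
    |∑ e : Edge 4 (2 * S + 1), (if e.1 0 = 0 ∧ e.2 ≠ 0 then f e else 0)| ≤
      3 * r.N * (2 * S + 1 : ℝ) ^ 3 := by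
  rw [CoulombFP.sum_edge_slice_eq]
  calc |∑ q : (Fin 3 → ZMod (2 * S + 1)) × Fin 3, f (Fin.cons 0 q.1, q.2.succ)|
      ≤ ∑ q : (Fin 3 → ZMod (2 * S + 1)) × Fin 3, |f (Fin.cons 0 q.1, q.2.succ)| :=
        Finset.abs_sum_le_sum_abs _ _
    _ ≤ (Finset.univ : Finset ((Fin 3 → ZMod (2 * S + 1)) × Fin 3)).card • (r.N : ℝ) :=
        Finset.sum_le_card_nsmul _ _ _ fun q _ => hf _
    _ = 3 * r.N * (2 * S + 1 : ℝ) ^ 3 := by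
        rw [Finset.card_univ, Fintype.card_prod, Fintype.card_fin, nsmul_eq_mul, Nat.cast_mul,
          SupMeasurable.card_slice]
        push_cast
        ring

/-- `-3 N (2S+1)³ ≤ twistedCoulombF r S j U h t`. [folklore] -/
theorem neg_le_twistedCoulombF (r : LatticeRep G) (S : ℕ) (j : Fin 3)
    (U : GaugeConfig 4 (2 * S + 1) G) (h : Site 4 (2 * S + 1) → G) (t : G) :
    -(3 * r.N * (2 * S + 1 : ℝ) ^ 3) ≤ twistedCoulombF r S j U h t := by
  unfold twistedCoulombF
  rw [neg_le_neg_iff]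
  exact (le_abs_self _).trans (abs_sum_slice_le r S
    (fun e => (r.ρ (gaugeTransform h U e *
      (if e.2 = j.succ ∧ (e.1 j.succ).val = 2 * S then t else 1))).trace.re)
    fun e => abs_re_trace_rho_le r _)

/-- `coulombF r S U h ≤ 3 N (2S+1)³`. [folklore] -/
theorem coulombF_le (r : LatticeRep G) (S : ℕ) (U : GaugeConfig 4 (2 * S + 1) G)
    (h : Site 4 (2 * S + 1) → G) : coulombF r S U h ≤ 3 * r.N * (2 * S + 1 : ℝ) ^ 3 := by
  unfold coulombF
  exact (neg_le_abs _).trans (abs_sum_slice_le r S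
    (fun e => (r.ρ (gaugeTransform h U e)).trace.re) fun e => abs_re_trace_rho_le r _)

/-- The range of the twisted functional over `(t, h)` is bounded below. [folklore] -/
theorem bddBelow_range_twistedCoulombF (r : LatticeRep G) (S : ℕ) (j : Fin 3)
    (U : GaugeConfig 4 (2 * S + 1) G) :
    BddBelow (Set.range fun th : G × (Site 4 (2 * S + 1) → G) =>
      twistedCoulombF r S j U th.2 th.1) :=
  ⟨-(3 * r.N * (2 * S + 1 : ℝ) ^ 3), by
    rintro _ ⟨th, rfl⟩
    exact neg_le_twistedCoulombF r S j U th.2 th.1⟩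

/-- The range of the slice Coulomb functional over `h` is bounded below. [folklore] -/
theorem bddBelow_range_coulombF (r : LatticeRep G) (S : ℕ) (U : GaugeConfig 4 (2 * S + 1) G) :
    BddBelow (Set.range fun h : Site 4 (2 * S + 1) → G => coulombF r S U h) :=
  ⟨-(3 * r.N * (2 * S + 1 : ℝ) ^ 3), by
    rintro _ ⟨h, rfl⟩
    exact (neg_le_twistedCoulombF r S 0 U h 1).trans_eq (twistedCoulombF_one r S 0 U h)⟩

/-- `twistMin ≤ perMin`: the trivial twist is allowed. [folklore] -/
theorem twistMin_le_perMin (r : LatticeRep G) (S : ℕ) (j : Fin 3)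
    (U : GaugeConfig 4 (2 * S + 1) G) : twistMin r S j U ≤ perMin r S U := by
  refine le_ciInf fun h => ?_
  calc twistMin r S j U ≤ twistedCoulombF r S j U h 1 :=
        ciInf_le (bddBelow_range_twistedCoulombF r S j U) ((1 : G), h)
    _ = coulombF r S U h := twistedCoulombF_one r S j U h

/-- `perMin ≤ 3 N (2S+1)³`. [folklore] -/
theorem perMin_le (r : LatticeRep G) (S : ℕ) (U : GaugeConfig 4 (2 * S + 1) G) :
    perMin r S U ≤ 3 * r.N * (2 * S + 1 : ℝ) ^ 3 :=
  (ciInf_le (bddBelow_range_coulombF r S U) 1).trans (coulombF_le r S U 1)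

/-- `-3 N (2S+1)³ ≤ twistMin`. [folklore] -/
theorem neg_le_twistMin (r : LatticeRep G) (S : ℕ) (j : Fin 3)
    (U : GaugeConfig 4 (2 * S + 1) G) : -(3 * r.N * (2 * S + 1 : ℝ) ^ 3) ≤ twistMin r S j U :=
  le_ciInf fun th => neg_le_twistedCoulombF r S j U th.2 th.1

/-! #### Continuity in `U` -/

/-- The twisted slice functional is jointly continuous in `(U, (t, h))`. [folklore] -/
theorem continuous_twistedCoulombF [IsTopologicalGroup G] (r : LatticeRep G) (S : ℕ)
    (j : Fin 3) :
    Continuous fun q : GaugeConfig 4 (2 * S + 1) G × (G × (Site 4 (2 * S + 1) → G)) =>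
      twistedCoulombF r S j q.1 q.2.2 q.2.1 := by
  unfold twistedCoulombF
  refine Continuous.neg (continuous_finsetSum _ fun e _ => ?_)
  by_cases he : e.1 0 = 0 ∧ e.2 ≠ 0
  · simp only [if_pos he]
    refine Complex.continuous_re.comp (Continuous.matrix_trace (r.continuous.comp ?_))
    by_cases hs : e.2 = j.succ ∧ (e.1 j.succ).val = 2 * S
    · simp only [if_pos hs, gaugeTransform]
      fun_prop
    · simp only [if_neg hs, gaugeTransform]
      fun_prop
  · simp only [if_neg he]
    exact continuous_const

/-- `perMin` is continuous in `U`: infimum over the compact gauge group of a jointly continuous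
function. [folklore] -/
theorem continuous_perMin [IsTopologicalGroup G] [CompactSpace G] (r : LatticeRep G) (S : ℕ) :
    Continuous fun U : GaugeConfig 4 (2 * S + 1) G => perMin r S U := by
  have h := isCompact_univ.continuous_sInf
    (f := fun (U : GaugeConfig 4 (2 * S + 1) G) (h : Site 4 (2 * S + 1) → G) => coulombF r S U h)
    (SupMeasurable.continuous_coulombF r S)
  simpa only [Set.image_univ, sInf_range, perMin] using h

/-- `twistMin` is continuous in `U`: infimum over the compact `G × (Site → G)` of a jointly
continuous function. [folklore] -/
theorem continuous_twistMin [IsTopologicalGroup G] [CompactSpace G] (r : LatticeRep G) (S : ℕ)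
    (j : Fin 3) : Continuous fun U : GaugeConfig 4 (2 * S + 1) G => twistMin r S j U := by
  have h := isCompact_univ.continuous_sInf
    (f := fun (U : GaugeConfig 4 (2 * S + 1) G) (th : G × (Site 4 (2 * S + 1) → G)) =>
      twistedCoulombF r S j U th.2 th.1)
    (continuous_twistedCoulombF r S j)
  simpa only [Set.image_univ, sInf_range, twistMin] using h

/-- The twist gap is continuous in `U`. [folklore] -/
theorem continuous_twistGap [IsTopologicalGroup G] [CompactSpace G] (r : LatticeRep G) (S : ℕ)
    (j : Fin 3) : Continuous (twistGap r S j) :=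
  (continuous_perMin r S).sub (continuous_twistMin r S j)

end TwistGapMeasurable

/-! ### The stub -/

open TwistGapMeasurable in
/-- **Stub `stub_twistGapMeasurable` (classical).** For a compact group `G` with a faithful
continuous unitary representation `r` (so `G` is second countable), on the torus `(2S+1)⁴`, the
twist gap `twistGap r S j = perMin r S - twistMin r S j` of the Coulomb gauge glass is Borel
measurable in the configuration `U` (it is continuous: infima over the compact index spaces
`Site → G`, `G × (Site → G)` of jointly continuous functions; Borel = product σ-algebra on the
second-countable compact `G^{edges}`), and `0 ≤ twistGap ≤ 6 N (2S+1)³` (the trivial twist is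
allowed, so `twistMin ≤ perMin`; unitarity `|Re tr ρ(g)| ≤ N` over the `3(2S+1)³` time-zero
spatial links bounds `|coulombF|, |twistedCoulombF|` by `3 N (2S+1)³`). [folklore] -/
theorem stub_twistGapMeasurable [IsTopologicalGroup G] [CompactSpace G] [MeasurableSpace G] [BorelSpace G]
    (r : LatticeRep G) (S : ℕ) (j : Fin 3) :
    Measurable (twistGap r S j) ∧
      ∀ U : GaugeConfig 4 (2 * S + 1) G, 0 ≤ twistGap r S j U ∧ twistGap r S j U ≤ 6 * r.N * (2 * S + 1 : ℝ) ^ 3 := by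
  haveI : SecondCountableTopology G :=
    (r.continuous.isClosedEmbedding r.injective).isEmbedding.secondCountableTopology
  refine ⟨(continuous_twistGap r S j).measurable, fun U => ⟨?_, ?_⟩⟩
  · exact sub_nonneg.2 (twistMin_le_perMin r S j U)
  · have h1 := perMin_le r S U
    have h2 := neg_le_twistMin r S j U
    unfold twistGap
    linarith

end Summit.QuantumFields.YangMills.Cruxes.CovarianceBound.TwistStiffness

end
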